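import Mathlib.Analysis.Calculus.MeanValue
import Mathlib.Analysis.Convex.Contractible
import Mathlib.AlgebraicTopology.FundamentalGroupoid.SimplyConnected
import Literature.Geometry.Lorentzian.MinkowskiCauchy
import Literature.Geometry.Lorentzian.MinkowskiCauchyGraph
import Literature.Geometry.Lorentzian.MinkowskiCauchyDevelopment
import Literature.Geometry.Lorentzian.MassInequalitiesProofs
import Literature.Geometry.Lorentzian.AsymptoticFlatnessProofs
import Literature.Geometry.Lorentzian.TrivialDataAdmissible
import Literature.Geometry.Lorentzian.DataEmbeddingConstraints
import Literature.Geometry.Lorentzian.SpacetimePositiveMassRigidity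
import HarnessLib

/-!
# Towards the rigid positive energy theorem: uniformly spacelike entire graphs are Cauchy

Sibling proof file (theorems only; no definition, no named fact — D-0026) of
`Literature.Geometry.Lorentzian.SpacetimePositiveMassRigidity`, which vendors the case `m = 0` of
Beig–Chruściel, J. Math. Phys. 37 (1996) 1939–1961, **Thm. 4.1** (the rigid positive energy
theorem) as the named fact `positive_mass_rigidity_spacetime`: complete one-ended data
`(X, h, k)` with the dominant energy condition, asymptotically flat of order `1` with decaying
sources and vanishing ADM energy have a Cauchy development which *is* Minkowski space-time
`(ℝ⁴, η, ∂ₜ)`.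

## The printed proof and what this file contributes

The printed proof of the case `m = 0` (loc. cit., §4, proof of Thm. 4.1, with App. A) runs:
(P0–P1) Witten's equation on the asymptotically flat end has solutions asymptotic to any constant
spinor; for `m = 0` Witten's identity makes them parallel for the Sen connection, and App. A,
(A.8)–(A.11), turns each parallel spinor into a solution `(N, Yⁱ)` of the *parallel Killing
initial data system* `DᵢYⱼ + N Kᵢⱼ = 0`, `DᵢN + KᵢⱼYʲ = 0` with null asymptotic value;
(P2–P6) the Killing development of a timelike combination is globally hyperbolic with Cauchy
surface `Σ`, geodesically complete and flat (three independent null parallel fields), hence its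
universal cover is Minkowski space-time (Wolf); (P7) "as `Σ̃` is a Cauchy surface for `M̄`, it is
necessarily a graph over a spacelike plane `t = 0` in `(ℝ⁴, η)`", so `Σ̃` has one end, `Σ` is
simply connected, `Σ̃ = Σ` and `M̂ = ℝ⁴`; "Moreover `i(Σ)` is an asymptotically flat Cauchy
surface in `(ℝ⁴, η)`".

None of (P0)–(P6) has a carrier at the pin (no spinor bundles, Dirac–Witten operators or
weighted elliptic theory on asymptotically flat `3`-manifolds; no Killing developments; no
"flat, complete, simply connected ⟹ Minkowski"; no universal cover of a manifold as a manifold),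
so the fact is not discharged here. What is proved is the last clause in the quantitative form in
which any proof of the embedding statement consumes it, for the tree's (corrected) notion
`LorentzianMetric.IsCauchyHypersurface` (O'Neill 1983, Def. 14.28; endless = without endpoint):

* `Minkowski.isCauchyHypersurface_range_graph` — **the entire graph `{(u(y), y)}` of a
  `θ`-Lipschitz function `u : ℝ³ → ℝ` with `θ < 1` is a Cauchy hypersurface of Minkowski
  space-time** `(ℝ⁴, η, ∂ₜ)`: every endless timelike curve meets it exactly once. (Along a future
  timelike curve `σ ↦ (t(σ), x(σ))` one has `‖x(σ₂) − x(σ₁)‖ ≤ t(σ₂) − t(σ₁)`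
  (`Minkowski.norm_spatial_sub_le`), so `φ = t − u ∘ x` increases at least like `(1 − θ) t`; it is
  continuous, strictly increasing and, `t` being unbounded in both directions along an endless
  curve (`Minkowski.not_bddAbove_time`, `not_bddBelow_time`), takes the value `0` exactly once.)
  The case `u = 0` is `Minkowski.isCauchyHypersurface_range_sliceEmbed` (`MinkowskiCauchy`).
* `Minkowski.isCauchyHypersurface_range_graph_of_fderiv` — the same for a differentiable `u`
  with `‖du‖ ≤ θ < 1` everywhere (mean value inequality), the form produced by the rigidity
  argument: the image of the isometric embedding is the graph of a smooth `u` with `|∇u| < 1`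
  pointwise and `∇u → 0` at infinity (asymptotic flatness), whence `sup |∇u| < 1`.

* `hasSourceDecay_trivialData`, `positive_mass_rigidity_spacetime_hypotheses_trivialData`,
  `positive_mass_rigidity_spacetime_conclusion_trivialData` — **non-vacuity of the fact at the
  model**: the trivial data `(ℝ³, δ, 0)` on the Minkowski slice with its end `trivialAFEnd`
  satisfy *every* hypothesis of `positive_mass_rigidity_spacetime` (dominant energy condition,
  asymptotic flatness of order `1`, source decay of every rate `q₀ > 0`, one end, ADM energy
  `0`) and its conclusion (`Minkowski.vacuumCauchyDevelopment`, `MinkowskiCauchyDevelopment`: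
  Minkowski space-time is a Cauchy development of the trivial data), all assembled from theorems
  of the tree. So neither side of the vendored implication is degenerate by construction (the
  trap that voided the statements over `Development`, see `CauchyDevelopment.lean`).

* `Minkowski.nonempty_homeomorph_of_isEmbedding_of_isCauchyHypersurface`,
  `nonempty_homeomorph_of_exists_cauchyDevelopment_eq_spacetime`,
  `positive_mass_rigidity_spacetime.nonempty_homeomorph` — **consequences of the conclusion**:
  a space embedded onto a Cauchy hypersurface of Minkowski space-time is homeomorphic to `ℝ³`
  (the image is the entire graph of a Lipschitz function over `{t = 0}`,
  `Minkowski.IsCauchyHypersurface.exists_lipschitzWith_eq_range_graph` of `MinkowskiCauchyGraph`,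
  and the spatial projection restricted to it is a homeomorphism onto `ℝ³`); hence data with a
  Cauchy development which is Minkowski space-time live on a manifold homeomorphic to `ℝ³` — in
  particular one-ended and simply connected, the printed "in particular `Σ̃` has only one
  asymptotically flat end … it follows that `Σ = Σ̃`" — and so do, granted the fact, all data
  meeting its hypotheses; `contractibleSpace_of_exists_cauchyDevelopment_eq_spacetime`,
  `simplyConnectedSpace_of_exists_cauchyDevelopment_eq_spacetime`,
  `positive_mass_rigidity_spacetime.contractibleSpace` record contractibility and `π₁ = 0`.

* `isVacuumConstraintSolution_of_exists_cauchyDevelopment_eq_spacetime`,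
  `energyDensity_eq_zero_of_exists_cauchyDevelopment_eq_spacetime`,
  `positive_mass_rigidity_spacetime.energyDensity_eq_zero` — **the clause `ρ ≡ J ≡ 0` of the
  printed theorem**, which the vendored statement leaves out, recovered from its conclusion: data
  with a Cauchy development which is Minkowski space-time are embedded in a Ricci-flat space-time
  (`Minkowski.isRicciFlat_holds`), so they solve the vacuum constraint equations
  (`InitialDataSet.isVacuumConstraintSolution_of_isVacuum`, the Gauss–Codazzi necessity of the
  constraints, Choquet-Bruhat 2009, Ch. VI, Thm. 3.3), i.e. `μ = 0` and `J = 0` pointwise.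

The hypothesis `θ < 1` (uniformly spacelike) cannot be weakened to `|∇u| < 1` pointwise: the
hyperboloid `t = √(1 + |y|²)` is a smooth spacelike entire graph which the endless timelike curve
`σ ↦ (σ, 1 + √(1 + σ²), 0, 0)` never meets (it stays outside the light cone `{t > |y|}`
containing the hyperboloid), so it is not a Cauchy hypersurface (Hawking–Ellis 1973, §5.1).

## References

* R. Beig, P. T. Chruściel, *Killing vectors in asymptotically flat space-times. I.*, J. Math.
  Phys. 37 (1996) 1939–1961, arXiv:gr-qc/9510015: Thm. 4.1 and its proof (§4), §5,
  App. A. [BeigChrusciel1996]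
* B. O'Neill, *Semi-Riemannian geometry*, Academic Press 1983, Ch. 14, Def. 14.28 and the remark
  following it (p. 415). [ONeillSemiRiemannian1983]
* S. W. Hawking, G. F. R. Ellis, *The large scale structure of space-time*, CUP 1973, §5.1, §6.2,
  §6.5.
-/

noncomputable section

open Bundle Set Filter Function Topology
open scoped Manifold ContDiff NNReal

namespace Literature.Geometry.Lorentzian

namespace Minkowski

/-- A point of `E4` lies on the entire graph `{(u(y), y) | y ∈ ℝ³}` iff its time coordinate is
the value of `u` at its spatial part (coordinate bookkeeping, as `E4.mem_range_sliceEmbed_iff`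
for `u = 0`). [folklore] -/
theorem mem_range_graph_iff (u : E3 → ℝ) (x : E4) :
    x ∈ range (fun y : E3 ↦ E4.ofTimeSpace (u y) y) ↔ x 0 = u (E4.spatial x) := by
  constructor
  · rintro ⟨y, rfl⟩
    simp
  · intro hx
    refine ⟨E4.spatial x, ?_⟩
    have h := E4.ofTimeSpace_time_spatial x
    rw [E4.time_apply, hx] at h
    exact h

/-- **Drift estimate.** Along a future timelike curve of Minkowski space-time defined on an
interval, the height `φ = t − u(x̲)` above the graph of a `θ`-Lipschitz function `u` grows at
least like `(1 − θ) t`: `(1 − θ)(t(σ₂) − t(σ₁)) ≤ φ(σ₂) − φ(σ₁)` for `σ₁ ≤ σ₂`, because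
`|u(x̲(σ₂)) − u(x̲(σ₁))| ≤ θ ‖x̲(σ₂) − x̲(σ₁)‖ ≤ θ (t(σ₂) − t(σ₁))`
(`Minkowski.norm_spatial_sub_le`). O'Neill 1983, Ch. 14, remark after Def. 14.28 (p. 415), made
quantitative. [cite: ONeillSemiRiemannian1983, Ch. 14, Def. 14.28 (p. 415)] -/
theorem sub_mul_le_height_sub {u : E3 → ℝ} {θ : ℝ≥0} (hu : LipschitzWith θ u)
    {γ : ℝ → E4} {s : Set ℝ} (hs : s.OrdConnected)
    (h : spacetime.metric.IsFutureTimelikeCurveOn spacetime.timeOrientation γ s)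
    {σ₁ σ₂ : ℝ} (h₁ : σ₁ ∈ s) (h₂ : σ₂ ∈ s) (h12 : σ₁ ≤ σ₂) :
    (1 - θ) * (γ σ₂ 0 - γ σ₁ 0) ≤
      (γ σ₂ 0 - u (E4.spatial (γ σ₂))) - (γ σ₁ 0 - u (E4.spatial (γ σ₁))) := by
  have hsp := norm_spatial_sub_le hs h h₁ h₂ h12
  have hlip : |u (E4.spatial (γ σ₂)) - u (E4.spatial (γ σ₁))| ≤
      θ * ‖E4.spatial (γ σ₂) - E4.spatial (γ σ₁)‖ := by
    rw [← Real.dist_eq, ← dist_eq_norm]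
    exact hu.dist_le_mul _ _
  have hθ0 : (0 : ℝ) ≤ θ := θ.coe_nonneg
  have hle : u (E4.spatial (γ σ₂)) - u (E4.spatial (γ σ₁)) ≤ θ * (γ σ₂ 0 - γ σ₁ 0) :=
    ((le_abs_self _).trans hlip).trans (mul_le_mul_of_nonneg_left hsp hθ0)
  linarith

/-- The height `φ = t − u(x̲)` above the graph of a `θ`-Lipschitz function, `θ < 1`, is strictly
increasing along a future timelike curve of Minkowski space-time defined on an interval (the
time coordinate is strictly increasing, `Minkowski.strictMonoOn_time`, and `φ` gains at least
the fraction `1 − θ > 0` of every increase of `t`). This is the uniqueness half of the Cauchy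
property. O'Neill 1983, Ch. 14, remark after Def. 14.28 (p. 415).
[cite: ONeillSemiRiemannian1983, Ch. 14, Def. 14.28 (p. 415)] -/
theorem strictMonoOn_height {u : E3 → ℝ} {θ : ℝ≥0} (hθ : θ < 1) (hu : LipschitzWith θ u)
    {γ : ℝ → E4} {s : Set ℝ} (hs : s.OrdConnected)
    (h : spacetime.metric.IsFutureTimelikeCurveOn spacetime.timeOrientation γ s) :
    StrictMonoOn (fun σ ↦ γ σ 0 - u (E4.spatial (γ σ))) s := by
  intro σ₁ h₁ σ₂ h₂ hlt
  have hdrift := sub_mul_le_height_sub hu hs h h₁ h₂ hlt.le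
  have ht : γ σ₁ 0 < γ σ₂ 0 := strictMonoOn_time hs h h₁ h₂ hlt
  have hθ1 : (θ : ℝ) < 1 := by exact_mod_cast hθ
  have hpos : 0 < (1 - (θ : ℝ)) * (γ σ₂ 0 - γ σ₁ 0) := mul_pos (by linarith) (by linarith)
  dsimp only
  linarith

/-- The height `φ = t − u(x̲)` above the graph of a Lipschitz function is continuous along a
future timelike curve (on its domain, where the curve is differentiable; `u` is continuous).
O'Neill 1983, Ch. 14, p. 402. [cite: ONeillSemiRiemannian1983, Ch. 14, p. 402] -/
theorem continuousOn_height {u : E3 → ℝ} {θ : ℝ≥0} (hu : LipschitzWith θ u)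
    {γ : ℝ → E4} {s : Set ℝ}
    (h : spacetime.metric.IsFutureTimelikeCurveOn spacetime.timeOrientation γ s) :
    ContinuousOn (fun σ ↦ γ σ 0 - u (E4.spatial (γ σ))) s := by
  refine (continuousOn_time h).sub ?_
  refine hu.continuous.comp_continuousOn (E4.spatial.continuous.comp_continuousOn ?_)
  exact fun σ hσ ↦ (hasDerivAt_of_isFutureTimelikeCurveOn h hσ).1.continuousAt.continuousWithinAt

/-- Along a *future endless* timelike curve of Minkowski space-time defined on an interval, the
height `φ = t − u(x̲)` above the graph of a `θ`-Lipschitz function, `θ < 1`, is unbounded above: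
past any parameter `σ₀` it dominates `(1 − θ)(t − t(σ₀)) + φ(σ₀)`, and `t` is unbounded above
(`Minkowski.not_bddAbove_time`). Hawking–Ellis 1973, §6.2; O'Neill 1983, Ch. 14, p. 415.
[cite: ONeillSemiRiemannian1983, Ch. 14, Def. 14.28 (p. 415)] -/
theorem not_bddAbove_height {u : E3 → ℝ} {θ : ℝ≥0} (hθ : θ < 1) (hu : LipschitzWith θ u)
    {γ : ℝ → E4} {s : Set ℝ} (hs : s.OrdConnected)
    (h : spacetime.metric.IsFutureTimelikeCurveOn spacetime.timeOrientation γ s)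
    (hend : IsFutureEndless γ s) :
    ¬ BddAbove ((fun σ ↦ γ σ 0 - u (E4.spatial (γ σ))) '' s) := by
  rintro ⟨M, hM⟩
  obtain ⟨σ₀, h₀⟩ := hend.nonempty
  have hθ1 : (θ : ℝ) < 1 := by exact_mod_cast hθ
  have h1θ : 0 < 1 - (θ : ℝ) := by linarith
  set φ : ℝ → ℝ := fun σ ↦ γ σ 0 - u (E4.spatial (γ σ)) with hφ
  -- the time coordinate would be bounded above by `t(σ₀) + (M − φ σ₀)/(1 − θ)`
  refine not_bddAbove_time hs h hend ⟨max (γ σ₀ 0) (γ σ₀ 0 + (M - φ σ₀) / (1 - θ)), ?_⟩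
  rintro _ ⟨σ, hσ, rfl⟩
  rcases le_total σ σ₀ with hle | hle
  · exact ((strictMonoOn_time hs h).monotoneOn hσ h₀ hle).trans (le_max_left _ _)
  · refine le_trans ?_ (le_max_right _ _)
    have hdrift := sub_mul_le_height_sub hu hs h h₀ hσ hle
    have hφσ : φ σ ≤ M := hM ⟨σ, hσ, rfl⟩
    have hkey : (1 - (θ : ℝ)) * (γ σ 0 - γ σ₀ 0) ≤ M - φ σ₀ := by
      simp only [hφ] at hφσ ⊢
      linarith
    have := (le_div_iff₀' h1θ).mpr hkey
    linarith

/-- Along a *past endless* timelike curve of Minkowski space-time defined on an interval, the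
height `φ = t − u(x̲)` above the graph of a `θ`-Lipschitz function, `θ < 1`, is unbounded below
(time dual of `not_bddAbove_height`, from `Minkowski.not_bddBelow_time`). Hawking–Ellis 1973,
§6.2; O'Neill 1983, Ch. 14, p. 415. [cite: ONeillSemiRiemannian1983, Ch. 14, Def. 14.28 (p. 415)] -/
theorem not_bddBelow_height {u : E3 → ℝ} {θ : ℝ≥0} (hθ : θ < 1) (hu : LipschitzWith θ u)
    {γ : ℝ → E4} {s : Set ℝ} (hs : s.OrdConnected)
    (h : spacetime.metric.IsFutureTimelikeCurveOn spacetime.timeOrientation γ s)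
    (hend : IsPastEndless γ s) :
    ¬ BddBelow ((fun σ ↦ γ σ 0 - u (E4.spatial (γ σ))) '' s) := by
  rintro ⟨M, hM⟩
  obtain ⟨σ₀, h₀⟩ := hend.nonempty
  have hθ1 : (θ : ℝ) < 1 := by exact_mod_cast hθ
  have h1θ : 0 < 1 - (θ : ℝ) := by linarith
  set φ : ℝ → ℝ := fun σ ↦ γ σ 0 - u (E4.spatial (γ σ)) with hφ
  -- the time coordinate would be bounded below by `t(σ₀) − (φ σ₀ − M)/(1 − θ)`
  refine not_bddBelow_time hs h hend ⟨min (γ σ₀ 0) (γ σ₀ 0 - (φ σ₀ - M) / (1 - θ)), ?_⟩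
  rintro _ ⟨σ, hσ, rfl⟩
  rcases le_total σ₀ σ with hle | hle
  · exact (min_le_left _ _).trans ((strictMonoOn_time hs h).monotoneOn h₀ hσ hle)
  · refine (min_le_right _ _).trans ?_
    have hdrift := sub_mul_le_height_sub hu hs h hσ h₀ hle
    have hφσ : M ≤ φ σ := hM ⟨σ, hσ, rfl⟩
    have hkey : (1 - (θ : ℝ)) * (γ σ₀ 0 - γ σ 0) ≤ φ σ₀ - M := by
      simp only [hφ] at hφσ ⊢
      linarith
    have := (le_div_iff₀' h1θ).mpr hkey
    linarith

/-- **Uniformly spacelike entire graphs are Cauchy hypersurfaces of Minkowski space-time.** For a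
`θ`-Lipschitz function `u : ℝ³ → ℝ` with `θ < 1`, the graph `{(u(y), y) | y ∈ ℝ³} ⊆ (ℝ⁴, η, ∂ₜ)`
(`Minkowski.spacetime`) is a Cauchy hypersurface in the corrected sense
`LorentzianMetric.IsCauchyHypersurface` (`Causality`): every endless timelike curve meets it
exactly once — the height `t − u(x̲)` is continuous, strictly increasing
(`strictMonoOn_height`) and unbounded in both directions (`not_bddAbove_height`,
`not_bddBelow_height`) along such a curve, so it vanishes at exactly one parameter. The case
`u = 0` is `Minkowski.isCauchyHypersurface_range_sliceEmbed`. This is the clause "`i(Σ)` is an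
asymptotically flat Cauchy surface in `(ℝ⁴, η)`" of Beig–Chruściel, J. Math. Phys. 37 (1996),
Thm. 4.1, in the form its proof produces it (§4, end of the proof: the image is an entire graph
over `{t = 0}`, uniformly spacelike by asymptotic flatness); O'Neill 1983, Ch. 14, Def. 14.28
and the remark following it (p. 415).
[cite: BeigChrusciel1996, Thm. 4.1 (last clause) and its proof, §4] -/
theorem isCauchyHypersurface_range_graph {u : E3 → ℝ} {θ : ℝ≥0} (hθ : θ < 1)
    (hu : LipschitzWith θ u) :
    spacetime.metric.IsCauchyHypersurface spacetime.timeOrientation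
      (range fun y : E3 ↦ E4.ofTimeSpace (u y) y) := by
  change ∀ (γ : ℝ → E4) (s : Set ℝ),
    spacetime.metric.IsEndlessTimelikeCurve spacetime.timeOrientation γ s →
      ∃! t, t ∈ s ∧ γ t ∈ range fun y : E3 ↦ E4.ofTimeSpace (u y) y
  intro γ s hγ
  obtain ⟨hs, h, hfut, hpast⟩ := hγ
  have hmono := strictMonoOn_height hθ hu hs h
  -- existence by the intermediate value theorem
  obtain ⟨a, ha, ha0⟩ : ∃ a ∈ s, γ a 0 - u (E4.spatial (γ a)) < 0 := by
    obtain ⟨_, ⟨a, ha, rfl⟩, hlt⟩ := not_bddBelow_iff.mp (not_bddBelow_height hθ hu hs h hpast) 0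
    exact ⟨a, ha, hlt⟩
  obtain ⟨b, hb, hb0⟩ : ∃ b ∈ s, 0 < γ b 0 - u (E4.spatial (γ b)) := by
    obtain ⟨_, ⟨b, hb, rfl⟩, hlt⟩ := not_bddAbove_iff.mp (not_bddAbove_height hθ hu hs h hfut) 0
    exact ⟨b, hb, hlt⟩
  obtain ⟨σ, hσ, hσ0⟩ : ∃ σ ∈ s, γ σ 0 - u (E4.spatial (γ σ)) = 0 :=
    hs.isPreconnected.intermediate_value ha hb (continuousOn_height hu h) ⟨ha0.le, hb0.le⟩
  refine ⟨σ, ⟨hσ, (mem_range_graph_iff u _).mpr (sub_eq_zero.mp hσ0)⟩, ?_⟩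
  rintro t ⟨ht, htS⟩
  have ht0 : γ t 0 - u (E4.spatial (γ t)) = 0 := sub_eq_zero.mpr ((mem_range_graph_iff u _).mp htS)
  exact hmono.injOn ht hσ (ht0.trans hσ0.symm)

/-- **Entire graphs with uniformly bounded slope `< 1` are Cauchy hypersurfaces of Minkowski
space-time**: if `u : ℝ³ → ℝ` is differentiable with `‖du(y)‖ ≤ θ < 1` for all `y`, then
`{(u(y), y)}` is a Cauchy hypersurface of `(ℝ⁴, η, ∂ₜ)` (`u` is `θ`-Lipschitz by the mean value
inequality, `lipschitzWith_of_nnnorm_fderiv_le`, and `isCauchyHypersurface_range_graph`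
applies). The form consumed by the rigidity argument of Beig–Chruściel, J. Math. Phys. 37 (1996),
Thm. 4.1 (§4, end of the proof), whose embedding has as image the graph of a smooth `u` with
`|∇u| < 1` and `∇u → 0` at infinity.
[cite: BeigChrusciel1996, Thm. 4.1 (last clause) and its proof, §4] -/
theorem isCauchyHypersurface_range_graph_of_fderiv {u : E3 → ℝ} {θ : ℝ≥0} (hθ : θ < 1)
    (hd : Differentiable ℝ u) (hb : ∀ y, ‖fderiv ℝ u y‖₊ ≤ θ) :
    spacetime.metric.IsCauchyHypersurface spacetime.timeOrientation
      (range fun y : E3 ↦ E4.ofTimeSpace (u y) y) :=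
  isCauchyHypersurface_range_graph hθ (lipschitzWith_of_nnnorm_fderiv_le hd hb)

end Minkowski

/-! ### Non-vacuity: the trivial data meet every hypothesis and the conclusion of the fact -/

section TrivialData

/-- **The trivial data have decaying sources of every rate**: for `(ℝ³, δ, 0)` on the Minkowski
slice and its end `trivialAFEnd`, `HasSourceDecay trivialAFEnd trivialData q₀` for every
`q₀ > 0` — the energy density read in the chart is `R(δ)/(16π) = 0`
(`energyDensityCoeff_of_isTimeSymmetric`, `trivialData_scalarCurvature_eq_zero`) and the
momentum density vanishes for time-symmetric data (`momentumDensityCoeff_of_isTimeSymmetric`),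
so every controlled quantity is identically `0`. Eichmair–Huang–Lee–Schoen 2016, §2 (the
`(μ, J)`-clause of asymptotic flatness, trivially met by vacuum data).
[cite: EichmairHuangLeeSchoen2016, §2] -/
theorem hasSourceDecay_trivialData [trivialData.metric.HasLeviCivita] {q₀ : ℝ} (hq₀ : 0 < q₀) :
    HasSourceDecay trivialAFEnd trivialData q₀ := by
  have hμ : energyDensityCoeff trivialAFEnd trivialData = fun _ ↦ 0 := by
    funext x
    rw [energyDensityCoeff_of_isTimeSymmetric trivialAFEnd trivialData_isTimeSymmetric x]
    unfold AFEnd.scalarCurvatureCoeff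
    split_ifs with hx
    · rw [trivialData_scalarCurvature_eq_zero, mul_zero]
    · rw [mul_zero]
  have hJ : ∀ i, momentumDensityCoeff trivialAFEnd trivialData i = fun _ ↦ 0 := fun i ↦
    funext fun x ↦
      momentumDensityCoeff_of_isTimeSymmetric trivialAFEnd trivialData_isTimeSymmetric i x
  have h0 : ∀ (m : ℕ) (p : ℝ), (fun x : E3 ↦ ‖iteratedFDeriv ℝ m (fun _ : E3 ↦ (0 : ℝ)) x‖)
      =O[Bornology.cobounded E3] fun x ↦ ‖x‖ ^ p := by
    intro m p
    refine Asymptotics.IsBigO.of_bound 0 (Filter.Eventually.of_forall fun x ↦ ?_)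
    have : iteratedFDeriv ℝ m (fun _ : E3 ↦ (0 : ℝ)) x = 0 := by
      rw [iteratedFDeriv_fun_zero]; rfl
    simp [this]
  refine ⟨hq₀, fun m _ ↦ ?_, fun i m _ ↦ ?_⟩
  · rw [hμ]; exact h0 m _
  · rw [hJ i]; exact h0 m _

/-- **The hypotheses of `positive_mass_rigidity_spacetime` are met by the trivial data**
`(ℝ³, δ, 0)` with the end `trivialAFEnd` of the Minkowski slice: the dominant energy condition
(`R(δ) = 0 ≥ 0` for time-symmetric data, `satisfiesDominantEnergyCondition_iff_of_isTimeSymmetric`),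
asymptotic flatness of order `1` (CK-strong flatness of mass `0`,
`trivialAFEnd_isStronglyAsymptoticallyFlatCK_holds`, implies DR-strong flatness implies order `1`,
`AFEnd.IsStronglyAsymptoticallyFlatDR.IsAsymptoticallyFlat_one_holds`), source decay
(`hasSourceDecay_trivialData`), one end (`isSoleEnd_trivialAFEnd`) and ADM energy `0`
(`hasADMEnergy_trivialData_holds`). Together with
`positive_mass_rigidity_spacetime_conclusion_trivialData` this certifies that the vendored
implication is degenerate on neither side. Beig–Chruściel 1996, Thm. 4.1 (the case of Minkowski
data, where `m = 0`); Christodoulou–Klainerman 1993, §1 (the trivial data).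
[cite: BeigChrusciel1996, Thm. 4.1] -/
theorem positive_mass_rigidity_spacetime_hypotheses_trivialData
    [trivialData.metric.HasLeviCivita] :
    trivialData.SatisfiesDominantEnergyCondition ∧ trivialAFEnd.IsAsymptoticallyFlat trivialData 1 ∧
      (∃ q₀, HasSourceDecay trivialAFEnd trivialData q₀) ∧ trivialAFEnd.IsSoleEnd ∧
      trivialAFEnd.HasADMEnergy trivialData 0 := by
  refine ⟨?_, ?_, ⟨1, hasSourceDecay_trivialData one_pos⟩, isSoleEnd_trivialAFEnd,
    hasADMEnergy_trivialData_holds⟩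
  · rw [satisfiesDominantEnergyCondition_iff_of_isTimeSymmetric trivialData_isTimeSymmetric]
    intro x
    rw [trivialData_scalarCurvature_eq_zero]
  · exact AFEnd.IsStronglyAsymptoticallyFlatDR.IsAsymptoticallyFlat_one_holds trivialAFEnd
      trivialData trivialAFEnd_isStronglyAsymptoticallyFlatCK_holds.isStronglyAsymptoticallyFlatDR

/-- **The conclusion of `positive_mass_rigidity_spacetime` holds for the trivial data**: the
trivial data `(ℝ³, δ, 0)` have a Cauchy development which *is* Minkowski space-time
`(ℝ⁴, η, ∂ₜ)` — the slice `{t = 0}` with unit normal `∂ₜ` (`Minkowski.vacuumCauchyDevelopment`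
of `MinkowskiCauchyDevelopment`, every field a theorem; `{t = 0}` is Cauchy by
`Minkowski.isCauchyHypersurface_range_sliceEmbed`, the case `u = 0` of
`Minkowski.isCauchyHypersurface_range_graph`). This is the instance of Beig–Chruściel 1996,
Thm. 4.1 at Minkowski data and the non-vacuity witness of the fact's conclusion.
[cite: BeigChrusciel1996, Thm. 4.1] -/
theorem positive_mass_rigidity_spacetime_conclusion_trivialData :
    ∃ 𝒟 : CauchyDevelopment trivialData, 𝒟.toSpacetime = Minkowski.spacetime :=
  ⟨Minkowski.vacuumCauchyDevelopment.toCauchyDevelopment, rfl⟩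

end TrivialData

/-! ### Consequences of the conclusion: the data manifold is homeomorphic to `ℝ³` -/

section Topology

/-- **A space embedded onto a Cauchy hypersurface of Minkowski space-time is homeomorphic to
`ℝ³`.** If `ι : X → ℝ⁴` is a topological embedding whose image is a Cauchy hypersurface of
`(ℝ⁴, η, ∂ₜ)`, then `X ≃ₜ ℝ³`: the image is the entire graph of a (`1`-Lipschitz, in particular
continuous) function `u` over `{t = 0}`
(`Minkowski.IsCauchyHypersurface.exists_lipschitzWith_eq_range_graph`), on which the spatial
projection is a homeomorphism onto `ℝ³` with inverse `y ↦ (u(y), y)`. Beig–Chruściel, J. Math.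
Phys. 37 (1996), proof of Thm. 4.1, §4, last paragraph ("it is necessarily a graph over a
spacelike plane `t = 0` … In particular `Σ̃` has only one asymptotically flat end").
[cite: BeigChrusciel1996, proof of Thm. 4.1, §4 (last paragraph)] -/
theorem Minkowski.nonempty_homeomorph_of_isEmbedding_of_isCauchyHypersurface {X : Type*}
    [TopologicalSpace X] {ι : X → E4} (hι : IsEmbedding ι)
    (hC : spacetime.metric.IsCauchyHypersurface spacetime.timeOrientation (range ι)) :
    Nonempty (X ≃ₜ E3) := by
  obtain ⟨u, hu, hrange⟩ := Minkowski.IsCauchyHypersurface.exists_lipschitzWith_eq_range_graph hC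
  -- the same equation of subsets of `E4` (the carrier of `Minkowski.spacetime` is `E4` by `rfl`)
  have hrange' : (range ι : Set E4) = range fun y : E3 ↦ E4.ofTimeSpace (u y) y := hrange
  have hgraph : Continuous fun y : E3 ↦ E4.ofTimeSpace (u y) y := by
    have : (fun y : E3 ↦ E4.ofTimeSpace (u y) y) =
        fun y ↦ u y • E4.basisVector 0 + E4.ofTimeSpace 0 y :=
      funext fun y ↦ E4.ofTimeSpace_eq_smul_add (u y) y
    rw [this]
    exact (hu.continuous.smul continuous_const).add (E4.continuous_ofTimeSpace 0)
  -- points of the image are `(u(x̲), x̲)`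
  have hpt : ∀ x ∈ range ι, E4.ofTimeSpace (u (E4.spatial x)) (E4.spatial x) = x := by
    intro x hx
    rw [hrange', mem_range_graph_iff] at hx
    rw [← hx, ← E4.time_apply, E4.ofTimeSpace_time_spatial]
  let H : range ι ≃ₜ E3 :=
    { toFun := fun p ↦ E4.spatial p.1
      invFun := fun y ↦ ⟨E4.ofTimeSpace (u y) y, hrange' ▸ mem_range_self y⟩
      left_inv := fun p ↦ Subtype.ext (hpt p.1 p.2)
      right_inv := fun y ↦ E4.spatial_ofTimeSpace (u y) y
      continuous_toFun := E4.spatial.continuous.comp continuous_subtype_val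
      continuous_invFun := hgraph.subtype_mk _ }
  exact ⟨hι.toHomeomorph.trans H⟩

/-- **Data with a Cauchy development which is Minkowski space-time live on `ℝ³`**: if the
`3`-dimensional data set `D` on `X` has a Cauchy development `𝒟` with
`𝒟.toSpacetime = Minkowski.spacetime` — the conclusion of `positive_mass_rigidity_spacetime` —
then `X` is homeomorphic to `ℝ³` (the embedding of `𝒟` is a topological embedding onto a
Cauchy hypersurface of `(ℝ⁴, η, ∂ₜ)`;
`Minkowski.nonempty_homeomorph_of_isEmbedding_of_isCauchyHypersurface`). In particular `X` has
one end and is simply connected: the clauses "`Σ̃` has only one asymptotically flat end … it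
follows that `Σ = Σ̃`, `M̂ = ℝ⁴`" of the proof of Beig–Chruściel, J. Math. Phys. 37 (1996),
Thm. 4.1 (§4, last paragraph). [cite: BeigChrusciel1996, proof of Thm. 4.1, §4 (last paragraph)] -/
theorem nonempty_homeomorph_of_exists_cauchyDevelopment_eq_spacetime {X : Type}
    [TopologicalSpace X] [ChartedSpace E3 X] [IsManifold (𝓡 3) ∞ X] [ConnectedSpace X]
    {D : InitialDataSet (𝓡 3) X}
    (h : ∃ 𝒟 : CauchyDevelopment D, 𝒟.toSpacetime = Minkowski.spacetime) :
    Nonempty (X ≃ₜ E3) := by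
  obtain ⟨⟨⟨S, ι, hι, ν, hν, hh, hk⟩, hC⟩, hS⟩ := h
  change S = Minkowski.spacetime at hS
  subst hS
  exact Minkowski.nonempty_homeomorph_of_isEmbedding_of_isCauchyHypersurface hι.isEmbedding hC

/-- **Granted the rigid positive energy theorem, zero-energy data live on `ℝ³`.** Under the
named fact `positive_mass_rigidity_spacetime` (Beig–Chruściel 1996, Thm. 4.1, `m = 0`), every
`3`-dimensional data set satisfying its hypotheses — dominant energy condition, asymptotic
flatness of order `1` with decaying sources on an end `e` which is the only end, and vanishing
ADM energy on `e` — is carried by a manifold homeomorphic to `ℝ³`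
(`nonempty_homeomorph_of_exists_cauchyDevelopment_eq_spacetime`); so such data are one-ended
and simply connected, and no non-orientable or multiply connected `X` can carry them (the
remark on orientability in the docstring of the fact). Beig–Chruściel, J. Math. Phys. 37
(1996), Thm. 4.1 and its proof, §4. [cite: BeigChrusciel1996, Thm. 4.1 and its proof, §4] -/
theorem positive_mass_rigidity_spacetime.nonempty_homeomorph
    (hfact : positive_mass_rigidity_spacetime)
    (X : Type) [TopologicalSpace X] [ChartedSpace E3 X] [IsManifold (𝓡 3) ∞ X] [T2Space X]
    [SecondCountableTopology X] [ConnectedSpace X]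
    (D : InitialDataSet (𝓡 3) X) [D.metric.HasLeviCivita] (e : AFEnd X)
    (hdec : D.SatisfiesDominantEnergyCondition) (haf : e.IsAsymptoticallyFlat D 1)
    (hsrc : ∃ q₀, HasSourceDecay e D q₀) (hsole : e.IsSoleEnd) (hE : e.HasADMEnergy D 0) :
    Nonempty (X ≃ₜ E3) :=
  nonempty_homeomorph_of_exists_cauchyDevelopment_eq_spacetime (hfact X D e hdec haf hsrc hsole hE)

/-- **Data whose Cauchy development is Minkowski space-time live on a contractible manifold**:
`X ≃ₜ ℝ³` (`nonempty_homeomorph_of_exists_cauchyDevelopment_eq_spacetime`) and `ℝ³` is convex,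
hence contractible. [cite: BeigChrusciel1996, proof of Thm. 4.1, §4 (last paragraph)] -/
theorem contractibleSpace_of_exists_cauchyDevelopment_eq_spacetime {X : Type}
    [TopologicalSpace X] [ChartedSpace E3 X] [IsManifold (𝓡 3) ∞ X] [ConnectedSpace X]
    {D : InitialDataSet (𝓡 3) X}
    (h : ∃ 𝒟 : CauchyDevelopment D, 𝒟.toSpacetime = Minkowski.spacetime) :
    ContractibleSpace X := by
  obtain ⟨φ⟩ := nonempty_homeomorph_of_exists_cauchyDevelopment_eq_spacetime h
  haveI : ContractibleSpace (univ : Set E3) :=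
    (convex_univ (𝕜 := ℝ) (E := E3)).contractibleSpace ⟨0, mem_univ _⟩
  exact (φ.trans (Homeomorph.Set.univ E3).symm).contractibleSpace

/-- **… in particular on a simply connected manifold** — the clause "`Σ` simply connected, so
`Σ = Σ̃`" of the proof of Beig–Chruściel 1996, Thm. 4.1 read backwards: the conclusion of the
rigid positive energy theorem forces `π₁(X) = 0`.
[cite: BeigChrusciel1996, proof of Thm. 4.1, §4 (last paragraph)] -/
theorem simplyConnectedSpace_of_exists_cauchyDevelopment_eq_spacetime {X : Type}
    [TopologicalSpace X] [ChartedSpace E3 X] [IsManifold (𝓡 3) ∞ X] [ConnectedSpace X]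
    {D : InitialDataSet (𝓡 3) X}
    (h : ∃ 𝒟 : CauchyDevelopment D, 𝒟.toSpacetime = Minkowski.spacetime) :
    SimplyConnectedSpace X := by
  haveI := contractibleSpace_of_exists_cauchyDevelopment_eq_spacetime h
  infer_instance

/-- **Granted the rigid positive energy theorem, zero-energy data are carried by a contractible,
in particular simply connected, `3`-manifold** (so no lens-space end, no `ℝP³ # ℝ³`, no wormhole
`S² × ℝ` can carry complete DEC data, asymptotically flat with one end and `m = 0`).
Beig–Chruściel, J. Math. Phys. 37 (1996), Thm. 4.1 and its proof, §4.
[cite: BeigChrusciel1996, Thm. 4.1 and its proof, §4] -/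
theorem positive_mass_rigidity_spacetime.contractibleSpace
    (hfact : positive_mass_rigidity_spacetime)
    (X : Type) [TopologicalSpace X] [ChartedSpace E3 X] [IsManifold (𝓡 3) ∞ X] [T2Space X]
    [SecondCountableTopology X] [ConnectedSpace X]
    (D : InitialDataSet (𝓡 3) X) [D.metric.HasLeviCivita] (e : AFEnd X)
    (hdec : D.SatisfiesDominantEnergyCondition) (haf : e.IsAsymptoticallyFlat D 1)
    (hsrc : ∃ q₀, HasSourceDecay e D q₀) (hsole : e.IsSoleEnd) (hE : e.HasADMEnergy D 0) :
    ContractibleSpace X ∧ SimplyConnectedSpace X :=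
  ⟨contractibleSpace_of_exists_cauchyDevelopment_eq_spacetime (hfact X D e hdec haf hsrc hsole hE),
    simplyConnectedSpace_of_exists_cauchyDevelopment_eq_spacetime
      (hfact X D e hdec haf hsrc hsole hE)⟩

end Topology

/-! ### The clause `ρ ≡ J ≡ 0`: the conclusion forces the vacuum constraints -/

section Vacuum

/-- **Data with a Cauchy development which is Minkowski space-time solve the vacuum constraint
equations.** If the `3`-dimensional data set `D` has a Cauchy development `𝒟` with
`𝒟.toSpacetime = Minkowski.spacetime` — the conclusion of `positive_mass_rigidity_spacetime` —
then `R(h) − |k|² + (tr k)² = 0` and `div k − d(tr k) = 0`: the development is a data embedding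
into the Ricci-flat space-time `(ℝ⁴, η)` (`Minkowski.isRicciFlat_holds`), and data embedded in a
vacuum space-time satisfy the constraints (twice-traced Gauss and traced Codazzi equations,
`InitialDataSet.isVacuumConstraintSolution_of_isVacuum`). This is the clause "Moreover, we must
have `ρ ≡ Jⁱ ≡ 0`" of Beig–Chruściel, J. Math. Phys. 37 (1996), Thm. 4.1 (case `m = 0`), which
the vendored statement omits; Choquet-Bruhat 2009, Ch. VI, Thm. 3.3.
[cite: BeigChrusciel1996, Thm. 4.1] -/
theorem isVacuumConstraintSolution_of_exists_cauchyDevelopment_eq_spacetime {X : Type}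
    [TopologicalSpace X] [ChartedSpace E3 X] [IsManifold (𝓡 3) ∞ X] [ConnectedSpace X]
    {D : InitialDataSet (𝓡 3) X} [D.metric.HasLeviCivita]
    (h : ∃ 𝒟 : CauchyDevelopment D, 𝒟.toSpacetime = Minkowski.spacetime) :
    D.IsVacuumConstraintSolution := by
  obtain ⟨⟨𝒮, hC⟩, hS⟩ := h
  refine InitialDataSet.isVacuumConstraintSolution_of_isVacuum 𝒮 ?_
  obtain ⟨S, ι, hι, ν, hν, hh, hk⟩ := 𝒮
  change S = Minkowski.spacetime at hS
  subst hS
  intro inst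
  exact @Minkowski.isRicciFlat_holds inst

/-- **`μ ≡ 0` and `J ≡ 0` for data whose Cauchy development is Minkowski space-time**: the
energy density `μ = (R(h) − |k|² + (tr k)²)/16π` and the momentum density
`J = (div k − d(tr k))/8π` vanish identically
(`isVacuumConstraintSolution_of_exists_cauchyDevelopment_eq_spacetime`). Beig–Chruściel 1996,
Thm. 4.1 ("`ρ ≡ Jⁱ ≡ 0`"); Bartnik–Isenberg 2004, (2.1)–(2.2).
[cite: BeigChrusciel1996, Thm. 4.1] -/
theorem energyDensity_eq_zero_of_exists_cauchyDevelopment_eq_spacetime {X : Type}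
    [TopologicalSpace X] [ChartedSpace E3 X] [IsManifold (𝓡 3) ∞ X] [ConnectedSpace X]
    {D : InitialDataSet (𝓡 3) X} [D.metric.HasLeviCivita]
    (h : ∃ 𝒟 : CauchyDevelopment D, 𝒟.toSpacetime = Minkowski.spacetime) (x : X) :
    D.energyDensity x = 0 ∧ D.momentumDensity x = 0 := by
  obtain ⟨hH, hM⟩ := isVacuumConstraintSolution_of_exists_cauchyDevelopment_eq_spacetime h x
  exact ⟨by rw [InitialDataSet.energyDensity, hH, zero_div],
    by rw [InitialDataSet.momentumDensity, hM, smul_zero]⟩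

/-- **Granted the rigid positive energy theorem, zero-energy data are vacuum data**
(`ρ ≡ J ≡ 0`): under the named fact `positive_mass_rigidity_spacetime` (Beig–Chruściel 1996,
Thm. 4.1, `m = 0`), every `3`-dimensional data set satisfying its hypotheses — dominant energy
condition, asymptotic flatness of order `1` with decaying sources on an end which is the only
end, vanishing ADM energy — has identically vanishing energy and momentum densities
(`energyDensity_eq_zero_of_exists_cauchyDevelopment_eq_spacetime`). Together with
`positive_mass_rigidity_spacetime.nonempty_homeomorph` this restores the full printed conclusion
of Thm. 4.1 from the vendored one. [cite: BeigChrusciel1996, Thm. 4.1] -/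
theorem positive_mass_rigidity_spacetime.energyDensity_eq_zero
    (hfact : positive_mass_rigidity_spacetime)
    (X : Type) [TopologicalSpace X] [ChartedSpace E3 X] [IsManifold (𝓡 3) ∞ X] [T2Space X]
    [SecondCountableTopology X] [ConnectedSpace X]
    (D : InitialDataSet (𝓡 3) X) [D.metric.HasLeviCivita] (e : AFEnd X)
    (hdec : D.SatisfiesDominantEnergyCondition) (haf : e.IsAsymptoticallyFlat D 1)
    (hsrc : ∃ q₀, HasSourceDecay e D q₀) (hsole : e.IsSoleEnd) (hE : e.HasADMEnergy D 0) (x : X) :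
    D.energyDensity x = 0 ∧ D.momentumDensity x = 0 :=
  energyDensity_eq_zero_of_exists_cauchyDevelopment_eq_spacetime
    (hfact X D e hdec haf hsrc hsole hE) x

end Vacuum

/-! ### The printed proof's architecture: analytic half and geometric half -/

section Reduction

/-- **The two halves of Beig–Chruściel's proof of the rigid positive energy theorem, as a
reduction.** The printed proof of Thm. 4.1 (`m = 0`) factors through the *translational KID
system with Minkowskian Gram matrix*: smooth lapses and shifts `(N_a, Y_a)_{a < 4}` on `Σ` with

  `h(∇ᵤY_a, w) = −N_a k(u, w)`,  `dN_a(u) = −k(u, Y_a)`,  `−N_a N_b + h(Y_a, Y_b) = η_{ab}`,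
  `N₀ > 0`

(App. A, (A.11)–(A.11.0): the KIDs built out of the Sen-parallel spinors; §4: their Lorentzian
Gram matrix). Namely

* **analytic half** (`hA`; Witten's equation on the complete AF end with `m = 0`, [PT82],
  [Herzlich], App. A): under the hypotheses of the theorem such `(N_a, Y_a)` exist globally on `Σ`;
* **geometric half** (`hG`; §4 with [C3, Lemma 1 and Thm. 1]): data on a one-ended
  asymptotically flat `Σ` carrying such `(N_a, Y_a)` are a Cauchy hypersurface of Minkowski
  space-time — locally this is `InitialDataSet.exists_spacelikeImmersion_minkowski_of_kids`
  (`TranslationalKIDImmersion.lean`) and conversely `Minkowski.kids_of_spacelikeImmersion`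
  (`MinkowskiHypersurfaceKIDs.lean`); globally it is the Killing development, the passage to the
  universal cover and the one-end argument of §4.

Granted both halves — stated here in the tree's vocabulary, as hypotheses — the named fact
follows (this theorem); neither half is a named fact of the tree.
[cite: BeigChrusciel1996, proof of Thm. 4.1, §4 and App. A] -/
theorem positive_mass_rigidity_spacetime_of_kids
    (hA : ∀ (X : Type) [TopologicalSpace X] [ChartedSpace E3 X] [IsManifold (𝓡 3) ∞ X]
      [T2Space X] [SecondCountableTopology X] [ConnectedSpace X]
      (D : InitialDataSet (𝓡 3) X) [D.metric.HasLeviCivita] (e : AFEnd X),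
      D.SatisfiesDominantEnergyCondition → e.IsAsymptoticallyFlat D 1 →
      (∃ q₀, HasSourceDecay e D q₀) → e.IsSoleEnd → e.HasADMEnergy D 0 →
      ∃ (N : Fin 4 → X → ℝ) (Y : Fin 4 → Π x : X, TangentSpace (𝓡 3) x),
        (∀ a, ContMDiff (𝓡 3) 𝓘(ℝ, ℝ) ∞ (N a)) ∧
        (∀ a, ContMDiff (𝓡 3) ((𝓡 3).prod (𝓡 3)) ∞
          fun x ↦ (TotalSpace.mk' E3 x (Y a x) : TangentBundle (𝓡 3) X)) ∧
        (∀ a (x : X) (v w : TangentSpace (𝓡 3) x),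
          D.metric.val x (D.metric.leviCivita (Y a) x v) w = -(N a x * D.k x v w)) ∧
        (∀ a (x : X) (v : TangentSpace (𝓡 3) x),
          mvfderiv (𝓡 3) (N a) x v = -(D.k x v (Y a x))) ∧
        (∀ (x : X) a b, -(N a x * N b x) + D.h.inner x (Y a x) (Y b x) =
          if a = b then (if a = 0 then -1 else 1) else 0) ∧
        ∀ x, 0 < N 0 x)
    (hG : ∀ (X : Type) [TopologicalSpace X] [ChartedSpace E3 X] [IsManifold (𝓡 3) ∞ X]
      [T2Space X] [SecondCountableTopology X] [ConnectedSpace X]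
      (D : InitialDataSet (𝓡 3) X) [D.metric.HasLeviCivita] (e : AFEnd X),
      e.IsAsymptoticallyFlat D 1 → e.IsSoleEnd →
      (∃ (N : Fin 4 → X → ℝ) (Y : Fin 4 → Π x : X, TangentSpace (𝓡 3) x),
        (∀ a, ContMDiff (𝓡 3) 𝓘(ℝ, ℝ) ∞ (N a)) ∧
        (∀ a, ContMDiff (𝓡 3) ((𝓡 3).prod (𝓡 3)) ∞
          fun x ↦ (TotalSpace.mk' E3 x (Y a x) : TangentBundle (𝓡 3) X)) ∧
        (∀ a (x : X) (v w : TangentSpace (𝓡 3) x),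
          D.metric.val x (D.metric.leviCivita (Y a) x v) w = -(N a x * D.k x v w)) ∧
        (∀ a (x : X) (v : TangentSpace (𝓡 3) x),
          mvfderiv (𝓡 3) (N a) x v = -(D.k x v (Y a x))) ∧
        (∀ (x : X) a b, -(N a x * N b x) + D.h.inner x (Y a x) (Y b x) =
          if a = b then (if a = 0 then -1 else 1) else 0) ∧
        ∀ x, 0 < N 0 x) →
      ∃ 𝒟 : CauchyDevelopment D, 𝒟.toSpacetime = Minkowski.spacetime) :
    positive_mass_rigidity_spacetime :=
  fun X _ _ _ _ _ _ D _ e hdec haf hsrc hsole hE ↦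
    hG X D e haf hsole (hA X D e hdec haf hsrc hsole hE)

end Reduction

end Literature.Geometry.Lorentzian

end
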